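import Literature.Geometry.Kaehler.KaehlerOsculatingTestFormsProofs
import Mathlib.LinearAlgebra.Multilinear.FiniteDimensional
import Mathlib.Topology.Algebra.Module.FiniteDimension

/-!
# Expansion of a smooth form in osculating test forms near a point

Sequel to `KaehlerOsculatingTestFormsProofs.lean` (same notation). Fix `x₀`, the frame `M_f`
and a smooth bump function `f` centred at `x₀` on whose closed support `M_f (e ·)` is invertible
and `C^∞`. Then every smooth `j`-form `α` on `M` is, **near `x₀`, a combination of test forms with
smooth real coefficients**:

  `α = ∑ᵢ ρᵢ • Θ_{f, εᵢ}` near `x₀`,  `ρᵢ ∈ C^∞(M, ℝ)`,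

where `(εᵢ)` is a basis of the (finite-dimensional) real vector space of `ℂ`-valued `j`-forms on
the model space and `ρᵢ = f · cᵢ`, `cᵢ (y') =` the `i`-th coordinate of
`(α.inChart x₀ (e y')) ∘ (M_f (e y')⁻¹)^{⊗j}` (`exists_expansion_testForms`). This is the frame
expansion used in Voisin's proof of Prop. 6.5 (with the osculating frame of Prop. 3.14).

## References

* C. Voisin, *Hodge Theory and Complex Algebraic Geometry I* (2002), Prop. 3.14, §6.1.1 Prop. 6.5.
  [Voisin2002]
-/

noncomputable section

open scoped Manifold ContDiff Topology
open Set Function Bundle Module Filter ContinuousAlternatingMap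
open Literature.Analysis.OperatorTheory Literature.NumberTheory.Transcendental

namespace Literature.Geometry.Kaehler

set_option quotPrecheck false

section Expansion

variable {E : Type*} [NormedAddCommGroup E] [NormedSpace ℂ E] [CompleteSpace E]
  {M : Type*} [TopologicalSpace M] [ChartedSpace E M] [IsManifold 𝓘(ℝ, E) ∞ M]
  (G : M → E →L[ℝ] E →L[ℝ] ℝ) (S : (E →L[ℝ] ℝ) →L[ℝ] E) (B : E →L[ℝ] E →L[ℝ] E) (x₀ : M)
  {j : ℕ}

set_option hygiene false in
/-- The chart at `x₀`. -/
local notation "e₀" => extChartAt 𝓘(ℝ, E) x₀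

set_option hygiene false in
/-- Its centre. -/
local notation "c₀" => extChartAt 𝓘(ℝ, E) x₀ x₀

set_option hygiene false in
/-- The derivative of the inverse chart at `y`. -/
local notation "Sc[" y "]" => tangentCoordChange 𝓘(ℝ, E) x₀
  ((extChartAt 𝓘(ℝ, E) x₀).symm y) ((extChartAt 𝓘(ℝ, E) x₀).symm y)

set_option hygiene false in
/-- The coordinate metric. -/
local notation "Ĝ[" y "]" => ContinuousLinearMap.bilinearComp
  (G ((extChartAt 𝓘(ℝ, E) x₀).symm y)) (Sc[y]) (Sc[y])

set_option hygiene false in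
/-- `A y⁻¹`. -/
local notation "Ai[" y "]" => Ring.inverse ((1 : E →L[ℝ] E) + B (y - c₀))

set_option hygiene false in
/-- The Gram operator of the transported metric. -/
local notation "Q[" y "]" => ContinuousLinearMap.comp S
  (ContinuousLinearMap.bilinearComp (Ĝ[y]) (Ai[y]) (Ai[y]))

set_option hygiene false in
/-- The square root near `1`. -/
local notation "√₁" => HasStrictFDerivAt.localInverse (fun X : E →L[ℝ] E ↦ X * X)
  (ContinuousLinearEquiv.smulLeft (Units.mk0 (2 : ℝ) two_ne_zero) : (E →L[ℝ] E) ≃L[ℝ] (E →L[ℝ] E))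
  1 hasStrictFDerivAt_mul_self_one

set_option hygiene false in
/-- The osculating unitary frame `M_f y = √(Q y) ∘ A y`. -/
local notation "Mf[" y "]" => (√₁ (Q[y]) * ((1 : E →L[ℝ] E) + B (y - c₀)))

set_option hygiene false in
/-- The frame map on the manifold `U_{y'} = M_f (e y') ∘ De_{y'}`. -/
local notation "U[" y' "]" => ContinuousLinearMap.comp (Mf[extChartAt 𝓘(ℝ, E) x₀ y'])
  (mfderiv 𝓘(ℝ, E) 𝓘(ℝ, E) (extChartAt 𝓘(ℝ, E) x₀) y')

set_option hygiene false in
/-- The test form `Θ_{f,η}`. -/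
local notation "Θ[" f ", " η "]" =>
  (fun y' : M ↦ (f y' : ℝ) • ContinuousAlternatingMap.compContinuousLinearMap η (U[y']))

omit [CompleteSpace E] in
/-- The real vector space of `ℂ`-valued continuous alternating `j`-forms on a finite-dimensional
space is finite-dimensional. [folklore] -/
theorem finite_continuousAlternatingMap [FiniteDimensional ℝ E] :
    Module.Finite ℝ (E [⋀^Fin j]→L[ℝ] ℂ) :=
  Module.Finite.of_injective
    ((ContinuousMultilinearMap.toMultilinearMapLinear (R' := ℝ)).comp
      (toContinuousMultilinearMapLinear (R := ℝ)))
    ((ContinuousMultilinearMap.toMultilinearMap_injective).comp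
      toContinuousMultilinearMap_injective)

/-- Pull-back is linear in the form: sums. [folklore] -/
theorem sum_compContinuousLinearMap {V₁ V₂ : Type*} [AddCommGroup V₁] [Module ℝ V₁]
    [TopologicalSpace V₁] [AddCommGroup V₂] [Module ℝ V₂] [TopologicalSpace V₂] {ι : Type*}
    (s : Finset ι) (γ : ι → V₂ [⋀^Fin j]→L[ℝ] ℂ) (T : V₁ →L[ℝ] V₂) :
    (∑ i ∈ s, γ i).compContinuousLinearMap T = ∑ i ∈ s, (γ i).compContinuousLinearMap T := by
  ext v
  simp [compContinuousLinearMap_apply]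

/-- Pull-back is linear in the form: real scalars. [folklore] -/
theorem smul_compContinuousLinearMap {V₁ V₂ : Type*} [AddCommGroup V₁] [Module ℝ V₁]
    [TopologicalSpace V₁] [AddCommGroup V₂] [Module ℝ V₂] [TopologicalSpace V₂]
    (r : ℝ) (γ : V₂ [⋀^Fin j]→L[ℝ] ℂ) (T : V₁ →L[ℝ] V₂) :
    (r • γ).compContinuousLinearMap T = r • γ.compContinuousLinearMap T := by
  ext v
  simp [compContinuousLinearMap_apply]

omit [CompleteSpace E] in
/-- **The chart representative through the form at the point**: for `y'` in the chart source,
`α.inChart x₀ (e y') = (α y') ∘ Sc[e y']^{⊗}` as forms on the model space. [folklore] -/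
theorem inChart_apply_chart (α : MForm 𝓘(ℝ, E) M ℂ j) {y' : M} (hy' : y' ∈ (e₀).source) :
    MForm.inChart α x₀ (e₀ y') = (α y').compContinuousLinearMap (Sc[e₀ y']) := by
  rw [MForm.inChart_eq_of_mem_target _ ((e₀).map_source hy')]
  exact congrArg (fun z : M ↦ ((α z).compContinuousLinearMap (Sc[e₀ y']) : E [⋀^Fin j]→L[ℝ] ℂ))
    ((e₀).left_inv hy')

/-- **Reconstruction of the form from its frame coefficients**: at a point `y'` of the chart source
where `M_f (e y')` is invertible, `((α.inChart x₀ (e y')) ∘ (M_f (e y')⁻¹)^{⊗}) ∘ U_{y'}^{⊗} = α y'`.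
[folklore] -/
theorem frameForm_compContinuousLinearMap (α : MForm 𝓘(ℝ, E) M ℂ j) {y' : M}
    (hy' : y' ∈ (e₀).source) (hu : IsUnit (Mf[e₀ y'])) :
    ((MForm.inChart α x₀ (e₀ y')).compContinuousLinearMap
        (Ring.inverse (Mf[e₀ y']))).compContinuousLinearMap (U[y']) = α y' := by
  rw [inChart_apply_chart x₀ α hy']
  ext v
  simp only [compContinuousLinearMap_apply]
  refine congrArg (α y') (funext fun i ↦ ?_)
  -- `Sc (M⁻¹ (M (De vᵢ))) = Sc (De vᵢ) = vᵢ`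
  have h1 : Ring.inverse (Mf[e₀ y']) (Mf[e₀ y'] (mfderiv 𝓘(ℝ, E) 𝓘(ℝ, E) (e₀) y' (v i))) =
      mfderiv 𝓘(ℝ, E) 𝓘(ℝ, E) (e₀) y' (v i) :=
    congrArg (fun T : E →L[ℝ] E ↦ T (mfderiv 𝓘(ℝ, E) 𝓘(ℝ, E) (e₀) y' (v i)))
      (Ring.inverse_mul_cancel _ hu)
  exact (congrArg (Sc[e₀ y']) h1).trans (symmDeriv_apply_chartDeriv x₀ hy' (v i))

variable [FiniteDimensional ℝ E] [T2Space M]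

/-- **Expansion of a smooth form in osculating test forms near `x₀`.** Let `f` be a smooth bump
function centred at `x₀` such that on its closed support `M_f (e ·)` is invertible (`hunit`) and
`C^∞` (`hMs`). Then for every smooth `j`-form `α` there are finitely many model forms `εᵢ` and
smooth real functions `ρᵢ` on `M` with `α = ∑ᵢ ρᵢ • Θ_{f,εᵢ}` near `x₀`. (Take `εᵢ` a basis of
the model `j`-forms and `ρᵢ = f · cᵢ`, `cᵢ` the coordinates of `(α.inChart x₀ ∘ e) ∘ (M_f⁻¹)^{⊗}`.)
[cite: Voisin2002, §6.1.1 Prop. 6.5] -/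
theorem exists_expansion_testForms (α : MForm 𝓘(ℝ, E) M ℂ j) (hα : IsSmoothForm α)
    (f : SmoothBumpFunction 𝓘(ℝ, E) x₀) (hunit : ∀ z ∈ tsupport f, IsUnit (Mf[e₀ z]))
    (hMs : ∀ z ∈ tsupport f, ContDiffAt ℝ ∞ (fun y ↦ Mf[y]) (e₀ z)) :
    ∃ (N : ℕ) (ε : Fin N → E [⋀^Fin j]→L[ℝ] ℂ) (ρ : Fin N → M → ℝ),
      (∀ i, ContMDiff 𝓘(ℝ, E) 𝓘(ℝ, ℝ) ∞ (ρ i)) ∧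
        ∀ᶠ y' in 𝓝 x₀, α y' = (∑ i, ρ i • Θ[f, ε i]) y' := by
  haveI : Module.Finite ℝ (E [⋀^Fin j]→L[ℝ] ℂ) := finite_continuousAlternatingMap
  set bV := Module.finBasis ℝ (E [⋀^Fin j]→L[ℝ] ℂ) with hbV
  -- coordinate functionals, as continuous linear maps
  set co : Fin (finrank ℝ (E [⋀^Fin j]→L[ℝ] ℂ)) → (E [⋀^Fin j]→L[ℝ] ℂ) →L[ℝ] ℝ :=
    fun i ↦ LinearMap.toContinuousLinearMap (bV.coord i) with hco
  -- the frame coefficients in the chart, and on `M`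
  set cE : Fin (finrank ℝ (E [⋀^Fin j]→L[ℝ] ℂ)) → E → ℝ := fun i y ↦
    co i ((MForm.inChart α x₀ y).compContinuousLinearMap (Ring.inverse (Mf[y]))) with hcE
  set ρ : Fin (finrank ℝ (E [⋀^Fin j]→L[ℝ] ℂ)) → M → ℝ := fun i y' ↦ f y' * cE i (e₀ y') with hρ
  refine ⟨_, bV, ρ, fun i ↦ ?_, ?_⟩
  · -- smoothness of `ρᵢ = f · (cEᵢ ∘ e)`
    refine contMDiff_of_tsupport fun z hz ↦ ?_
    have hz' : z ∈ tsupport f := tsupport_mul_subset_left hz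
    have hzc : z ∈ (chartAt E x₀).source := f.tsupport_subset_chartAt_source hz'
    have hzs : z ∈ (e₀).source := by rwa [extChartAt_source]
    -- `cEᵢ` is `C^∞` at `e z`
    have hin : ContDiffAt ℝ ∞ (MForm.inChart α x₀) (e₀ z) := by
      have h1 := (MForm.smoothAt_iff_contDiffWithinAt_inChart hzs).1 (hα z)
      rwa [ModelWithCorners.Boundaryless.range_eq_univ, contDiffWithinAt_univ] at h1
    have hinv : ContDiffAt ℝ ∞ (Ring.inverse ∘ fun y ↦ Mf[y]) (e₀ z) :=
      (contDiffAt_ringInverse ℝ (hunit z hz').unit).comp (e₀ z) (hMs z hz')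
    have hcE' : ContDiffAt ℝ ∞ (cE i) (e₀ z) :=
      (co i).contDiff.contDiffAt.comp (e₀ z)
        (ContDiffAt.continuousAlternatingMapCompContinuousLinearMap hin hinv)
    have hcM : ContMDiffAt 𝓘(ℝ, E) 𝓘(ℝ, ℝ) ∞ (fun y' ↦ cE i (e₀ y')) z :=
      hcE'.contMDiffAt.comp z (contMDiffAt_extChartAt' hzc)
    exact f.contMDiff.contMDiffAt.mul hcM
  · -- the expansion near `x₀`
    have h1 : ∀ᶠ y' in 𝓝 x₀, f y' = 1 := f.eventuallyEq_one
    filter_upwards [h1, extChartAt_source_mem_nhds (I := 𝓘(ℝ, E)) x₀] with y' hf1 hsrc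
    have hts : y' ∈ tsupport f := subset_tsupport _ (by simp [hf1])
    have hu := hunit y' hts
    rw [Finset.sum_apply]
    -- each summand at `y'`
    have hsum : ∀ i, (ρ i • Θ[f, bV i]) y' =
        ContinuousAlternatingMap.compContinuousLinearMap
          (bV.repr ((MForm.inChart α x₀ (e₀ y')).compContinuousLinearMap
            (Ring.inverse (Mf[e₀ y']))) i • bV i) (U[y']) := by
      intro i
      change ρ i y' • (f y' • ContinuousAlternatingMap.compContinuousLinearMap (bV i) (U[y'])) = _
      rw [hf1, one_smul, smul_compContinuousLinearMap]
      congr 1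
      simp only [hρ, hcE, hco, hf1, one_mul, LinearMap.coe_toContinuousLinearMap', Basis.coord_apply]
    simp only [hsum]
    rw [← sum_compContinuousLinearMap, Basis.sum_repr,
      frameForm_compContinuousLinearMap G S B x₀ α hsrc hu]

end Expansion

end Literature.Geometry.Kaehler
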